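/-
Origin: expansion seat `planner-pub-hodgecm-pv11-g3-0`, handover #1 2026-08-18T06:13:17Z (`HOME/pub-hodgecm-pv11-g3/lean/Pv11g3/SupplyStrength.lean`, md5 9b2047b0, 177 lines);
landed by the gen-6 packager in gate run 24 as `HodgeCM/PerL34/SupplyStrength.lean` (import ^import Pv[0-9]+g[0-9]+\.→import HodgeCM.PerL34. ×1).
-/
/-
Origin: HOME/pub-hodgecm-pv11-g3/lean/Pv11g3/SupplyStrength.lean — session planner-pub-hodgecm-pv11-g3-0
(unit pub-hodgecm-pv11-g3, DAG-NODE PROVER #11 gen 3).  Intended place: `HodgeCM/PerL34/SupplyStrength.lean`;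
import rewrite on landing: `Pv11g3.SupplyAdelic → HodgeCM.PerL34.SupplyAdelic` (the other import is the LANDED toy
`HodgeCM.Model.Toy.SupplyCircleModel`).
-/
import Summits.HodgeConjecture.HodgeCM.Model.Toy.SupplyCircleModel
import Summits.HodgeConjecture.HodgeCM.PerL34.SupplyAdelic

/-!
# Strength of the route-(E) bridge records: CONSERVATIVE over their conclusion (referee A, P1 shape)

For the seam table (LEMMAS § 9, S5) and FACTS § 0: the route-(E) records `SupplyDictionaryE.SupplyBridgeE T V c k`
(gen 2, run 22) and `SupplyAdelic.SupplyBridgeA T V c k` (gen 3) are each EQUIVALENT, as propositions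
(`Nonempty`), to their conclusion `∃ Γ, ∃ ω ∈ T.Theta V c k Γ, ω ≠ 0`; consequently the hypothesis of
`open_supply_of_bridgesE` / `open_supply_of_bridgesA` is equivalent to `T.Open_supply` itself
(`open_supply_iff_bridgesE`, `open_supply_iff_bridgesA`).  Exactly as for the S5 realisation bridge
(`S5Conservative.nonempty_bridge_iff`, pv08-g2) this says: the records add NO logical strength to the open
input they feed; their content is the LABELLING — which sentences an instantiation by the intended adelic
objects must verify, and at what level (SETUP / definition-level DICTIONARY / the one D5 sentence `weight` /
PRINT Weil 1964 / the RESIDUAL `form_of_lift`).  Gen 3's contribution over gen 2 is therefore not strength but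
RESOLUTION: `hker`, `heq` are no longer trusted sentences but theorems of smaller ones.

The converse directions are witnessed by the landed weight-`1` circle model (`Model/Toy/SupplyCircleModel`):
every non-residual field of either record is DISCHARGED there by unfolding definitions (the torus acts through
a character, `ω(u) φ = u • φ`, a genuine representation by homogeneous operators; rational points `⊥`, so the
automorphic quotient is the circle itself), and the residual field is the assumed conclusion.

No statement of the 2001 programme, of PerL or of QW8 is used or cited.
-/

set_option autoImplicit false

noncomputable section

open MeasureTheory
open scoped SchwartzMap
open HodgeCM.PerL34.Seesaw HodgeCM.PerL34.SupplyElementary HodgeCM.PerL34.RationalCoset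
  HodgeCM.PerL34.SupplyToyModel HodgeCM.PerL34.SupplyAdelic

namespace HodgeCM
namespace PerL34
namespace SupplyStrength

variable {U : Universe} (T : U.ThetaModel)
variable {L : CMField} {ι₁ : L →+* ℂ} (V : HermSpace3 L ι₁) (c : SeesawCtx L) (k : Fin 4)

/-! ### The circle with trivial rational subgroup: instances on the quotient -/

section Instances

attribute [local instance] borelCircle borelSpace_circle

/-- Local: the quotient of the circle by the trivial subgroup is Hausdorff. -/
theorem t2Space_circleQuot : T2Space (Circle ⧸ (⊥ : Subgroup Circle)) := t2Space_quotient

attribute [local instance] t2Space_circleQuot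

/-- Local: the Borel σ-algebra on the quotient. -/
@[reducible] def borelCircleQuot : MeasurableSpace (Circle ⧸ (⊥ : Subgroup Circle)) := borel _

attribute [local instance] borelCircleQuot

/-- (Ported verbatim from the HodgeCMPerL package; no docstring in the source.) -/
theorem borelSpace_circleQuot : BorelSpace (Circle ⧸ (⊥ : Subgroup Circle)) := ⟨rfl⟩

attribute [local instance] borelSpace_circleQuot

/-- The rational base point of the toy. -/
abbrev x₀ : ℚ := 0

/-- **The gen-3 record in the weight-1 circle model**, given its conclusion: every SETUP / DICTIONARY / D5 /
PRINT field is discharged by unfolding (`rfl`, `simp`, the toy lemmas of `SupplyCircleModel`); the RESIDUAL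
field is the hypothesis `h`. -/
def toyBridgeA (h : ∃ Γ : Level V, ∃ ω ∈ T.Theta V c k Γ, ω ≠ 0) : SupplyBridgeA T V c k where
  DS := circleModel 1
  rat := ⊥
  ν := Measure.haar
  B := Circle
  i := MonoidHom.id Circle
  w := fun t => (t : ℂ) ^ 1
  VK := ℚ
  Vf := ℚ
  ιf := SupplyToyModel.ιf
  Lhat := SupplyToyModel.Lhat
  E := ℝ
  LE := SupplyToyModel.LE
  ι := ιR
  hL := mem_LE_of_mem
  hinj := injOn_ιR
  f := bump (ιR x₀)
  x₀ := x₀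
  hx₀ := by rw [bump_apply_self]; exact one_ne_zero
  φN := phiN (bump (ιR x₀)) x₀
  g₀ := ()
  eX := Equiv.refl ℚ
  ev_phiN := fun _ _ _ => rfl
  act_one := fun φ => funext fun x => by simp
  act_mul := fun u v φ => funext fun x => by simp [mul_assoc]
  act_smul := fun u a φ => funext fun x => by simp [mul_left_comm]
  ev_smul := fun _ _ _ => rfl
  weight := fun N t => funext fun x => by simp
  cont := fun N => continuous_thetaKernel₁ 1 _ ()
  inv := fun N γ hγ u => by rw [Subgroup.mem_bot] at hγ; rw [hγ, one_mul]
  form_of_lift := fun _ _ _ _ _ => h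

/-- **The gen-2 record in the weight-1 circle model**, given its conclusion (the torus IS the compact group). -/
def toyBridgeE (h : ∃ Γ : Level V, ∃ ω ∈ T.Theta V c k Γ, ω ≠ 0) : SupplyDictionaryE.SupplyBridgeE T V c k where
  DS := circleModel 1
  ν := Measure.haar
  sep := charSeparating_circle
  B := Circle
  i := MonoidHom.id Circle
  w := fun t => (t : ℂ) ^ 1
  VK := ℚ
  Vf := ℚ
  ιf := SupplyToyModel.ιf
  Lhat := SupplyToyModel.Lhat
  E := ℝ
  LE := SupplyToyModel.LE
  ι := ιR
  hL := mem_LE_of_mem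
  hinj := injOn_ιR
  f := bump (ιR x₀)
  x₀ := x₀
  hx₀ := by rw [bump_apply_self]; exact one_ne_zero
  φN := phiN (bump (ιR x₀)) x₀
  g₀ := ()
  u₀ := 1
  hker := fun N _ => thetaKernel₁_one 1 (phiN (bump (ιR x₀)) x₀ N) ()
  hcont := fun N => continuous_thetaKernel₁ 1 _ ()
  heq := fun N u t => thetaKernel₁_mul 1 _ () u t
  form_of_lift := fun _ _ _ _ _ => h

end Instances

variable {T V c k}

/-- **CONSERVATIVITY of the gen-3 record**: it is equivalent to its conclusion. -/
theorem nonempty_supplyBridgeA_iff :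
    Nonempty (SupplyBridgeA T V c k) ↔ ∃ Γ : Level V, ∃ ω ∈ T.Theta V c k Γ, ω ≠ 0 :=
  ⟨fun ⟨Br⟩ => Br.supply_of_bridgeA, fun h => ⟨toyBridgeA T V c k h⟩⟩

/-- **CONSERVATIVITY of the gen-2 record**: it is equivalent to its conclusion. -/
theorem nonempty_supplyBridgeE_iff :
    Nonempty (SupplyDictionaryE.SupplyBridgeE T V c k) ↔ ∃ Γ : Level V, ∃ ω ∈ T.Theta V c k Γ, ω ≠ 0 :=
  ⟨fun ⟨Br⟩ => SupplyDictionaryE.supply_of_bridgeE Br, fun h => ⟨toyBridgeE T V c k h⟩⟩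

/-- The two generations of records are equivalent as propositions. -/
theorem nonempty_supplyBridgeA_iff_E :
    Nonempty (SupplyBridgeA T V c k) ↔ Nonempty (SupplyDictionaryE.SupplyBridgeE T V c k) :=
  nonempty_supplyBridgeA_iff.trans nonempty_supplyBridgeE_iff.symm

variable (T) in
/-- **`Open_supply` ⟺ gen-3 bridge records for `k = 0, 1` in every good context.** -/
theorem open_supply_iff_bridgesA :
    T.Open_supply ↔
      ∀ {L : CMField} {ι₁ : L →+* ℂ} (V : HermSpace3 L ι₁) (c : SeesawCtx L), T.GoodCtx ι₁ c →
        Nonempty (SupplyBridgeA T V c 0) ∧ Nonempty (SupplyBridgeA T V c 1) := by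
  refine ⟨fun hS L ι₁ V c hc => ?_, fun hB => open_supply_of_bridgesA T hB⟩
  obtain ⟨h0, h1⟩ := hS V c hc
  exact ⟨nonempty_supplyBridgeA_iff.2 h0, nonempty_supplyBridgeA_iff.2 h1⟩

variable (T) in
/-- **`Open_supply` ⟺ gen-2 bridge records for `k = 0, 1` in every good context.** -/
theorem open_supply_iff_bridgesE :
    T.Open_supply ↔
      ∀ {L : CMField} {ι₁ : L →+* ℂ} (V : HermSpace3 L ι₁) (c : SeesawCtx L), T.GoodCtx ι₁ c →
        Nonempty (SupplyDictionaryE.SupplyBridgeE T V c 0) ∧ Nonempty (SupplyDictionaryE.SupplyBridgeE T V c 1) := by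
  refine ⟨fun hS L ι₁ V c hc => ?_, fun hB => SupplyDictionaryE.open_supply_of_bridgesE T hB⟩
  obtain ⟨h0, h1⟩ := hS V c hc
  exact ⟨nonempty_supplyBridgeE_iff.2 h0, nonempty_supplyBridgeE_iff.2 h1⟩

end SupplyStrength
end PerL34
end HodgeCM

end
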